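import Summits.BirchSwinnertonDyer.Rank1Residual.X1.RankOneSigmaDischarged
import Summits.BirchSwinnertonDyer.Rank1Residual.X1.AnomalousPointCount
import Summits.BirchSwinnertonDyer.Rank1Residual.X2.ClassClosureEntireFree
import HarnessLib

/-!
# X1 ∩ {r = 1}: the class assembly and the N1 row record on SEVEN published binders — every binder
# that the tree itself PROVES or DERIVES is fed (Mazur–Tate `σ`; Greenberg 4.1; modularity once)

HONEST FRAMING (cell `b2b-bsdres`, run/shared/lean/b2b/bsd-rank1-residual/, verbatim in every file):
the goal of the cell is to DELETE the COMBINATION-SHAPED residual classes of the Birch–Swinnerton-Dyer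
formula for ALL analytic-rank `≤ 1` elliptic curves over `ℚ` — "full BSD formula for every rank `≤ 1`
curve in class `C`" assembled STRICTLY from published theorems — so that the rank-`≤ 1` remainder
becomes exactly the CONSTRUCTION-SHAPED classes, which are TYPED (missing-input `Prop`s), NOT
attempted. This is not "finishing BSD". CLASS-OWNERS.md row "X1 (r = 1)": research route; NO CLAIM
BEYOND STATED CLASSES; no label change; the announced preprint Keller–Yin arXiv:2402.12781v2 enters ONLY
as an explicitly labelled OPEN hypothesis; PER-PAIR certificate shape for the row record; nothing is
booked by this file; no definition, no named fact.

Unit `b2b-bsdres-x1a` (X1 prover A, gen 21). WHAT. The x1a class assembly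
`RankOne.bsdpOnClassX1_of_KY_of_rankZeroDisplay_of_schneider` (`X1/RankOneRoutes.lean`, gen 9) and the
N1 lane offer's row record `RankOne.Leaf.bsdp_of_isIsogenous_of_certificateRowSha_two`
(`X1/AnomalousPointCount.lean`, gen 19) DISPLAY, besides the preprint displays / per-pair certificates,
TEN resp. NINE named published facts. Three of those displayed facts are supplied BY THE TREE:

* `mazur_tate_sigma_exists_odd` (A34; Mazur–Tate 1991 Thm. 3.1 / MST 2006 Thm. 1.3) is the THEOREM
  `X1.PadicSigmaThree.mazur_tate_sigma_exists_odd_holds` (x1a gen 20);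
* `greenberg_charValue_rankZero` (Greenberg 1999 Thm. 4.1) is DERIVED from
  `Schneider1985_order_charGenerator_odd` (BMS 2016 Thm. 1.7, `p > 2`) and A34:
  `greenberg_charValue_rankZero_of_Schneider1985_odd` (`Greenberg1999/…OddPrimeProofs`), fed as
  `RankOne.greenberg_charValue_rankZero_of_odd` (`X1/RankOneSigmaDischarged.lean`, gen 21);
* the second modularity binder — `exists_isNewformOf` (BCDT Thm. A "Version `L`") in the class
  assembly, `hasEntireLFunction_rat` (Hecke continuation of `L(E,s)`) in the row record — is DERIVED
  from the first, `nonempty_modularParametrizationData` (BCDT Thm. A in form (6)):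
  `exists_isNewformOf_of_nonempty_modularParametrizationData` (`ModularParametrizationBCDTProofs`,
  BCDT p. 845 "(6) ⇒ (2)": global minimal model + `IsNewformOf.of_smul`) and
  `WeierstrassCurve.hasEntireLFunction_rat_of_exists_isNewformOf` (`AnalyticRankModularityProofs`,
  Diamond–Shurman Thm. 5.10.2 / §8.8 — Hecke's continuation is a theorem of the tree), composed in the
  tree as `X2.ClassClosureEntireFree.hasEntireLFunction_rat_of_nonempty_modularParametrizationData`
  (harvest, X2 closing forms) — reused here, not restated.

Feeding all three (statements otherwise VERBATIM; double-primed names):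

* §1 THE CLASS: `bsdpOnClassX1_of_KY_of_rankZeroDisplay_of_schneider''` — the typed class target
  `BSDpOnClassX1` (X1, both ranks) from the two Keller–Yin displays (PREPRINT, explicit hypotheses),
  Schneider certificates at rank-one TYPE-B pairs only, and SEVEN published named facts:
  Greenberg–Vatsal 2000 Thm. (1.3) · Perrin-Riou–Schneider (BMS 1.7, odd `p`) · Perrin-Riou 1987 ·
  modularity (BCDT Thm. A, form (6)) · Hoffstein–Luo 1997 · Gross–Zagier I.7.3 · Gross–Zagier–Kolyvagin;
  with `statement_of_KY_of_schneider_typeB''` (the rank-one leaf, same seven),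
  `Leaf.bsdp_of_not_gvPar_of_KY''` and `bsdpOnClassX1_iff_rankZeroStatement_of_KY''`.
* §2 THE ROW RECORD of OFFER v1.5 (9 199 / 9 199 rank-one N1/N1′ cells, `N < 5·10⁵`):
  `Leaf.bsdp_of_isIsogenous_of_certificateRowSha_two''` on SEVEN published named facts:
  Wuthrich 2014 Thm. 16 · Perrin-Riou–Schneider (BMS 1.7, odd `p`) · Perrin-Riou 1987 · modularity
  (BCDT form (6)) · Gross–Zagier–Kolyvagin · Cassels 1965 (isogeny invariance) · Cassels–Tate.

WHY THIS IS THE TERMINAL LIST (X1-CHAIN.md §30). Of the remaining facts none is prover-sized and none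
is derived in the tree from other members of the list (the tree's derivations of GV (1.3), HL 1997,
GZK and Cassels run through FURTHER named facts — Tate uniformisation and the GV §3 inputs, first
moments of twisted `L`-values, Gross–Zagier + Kolyvagin over `K`, Milne I.7.3.1 — not through
members): GV Thm. (1.3) (anticyclotomic-to-cyclotomic comparison of
`μ`/`λ` under the parity condition), BMS 1.7 (the algebraic `p`-adic BSD formula: control + height
pairing via Iwasawa theory), PR 1987 (the `p`-adic Gross–Zagier formula), BCDT (modularity), HL 1997
(non-vanishing of quadratic twists), GZ I.7.3, GZK (Kolyvagin's Euler system), Wuthrich Thm. 16 (Kato's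
divisibility at a reducible prime), Cassels 1965 (global duality), Cassels–Tate (the pairing). The two
NON-published inputs are exactly Keller–Yin Thms. 3.0.11 + 7.0.6 (PRE) and Schneider's conjecture at
anomalous type-B pairs (OPEN class-wide; per pair the finite certificate). No class LABEL changes.

References: `X1/RankOneRoutes.lean` (p204810), `X1/AnomalousPointCount.lean` (p309788),
`X1/RankOneCertificateRowsSigma.lean` (p328883), `X1/RankOneSigmaDischarged.lean` (gen 21, `σ` and
Greenberg 4.1 fed; this file adds the modularity merge); HOME/b2b-bsdres-x1a/X1-CHAIN.md §30;
[KellerYin2024] Thm. 4.2.1 (PRE); [GreenbergVatsal2000] Thm. (1.3); [BalakrishnanMullerStein2015]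
Thm. 1.7; [PerrinRiou1987] §1.4; [BCDTJAMS2001] Thm. A and p. 845; [DiamondShurman2005] Thm. 5.10.2,
Thm. 8.8.3; [Wuthrich2014] Thm. 16; [MazurSteinTate2006] Thm. 1.3; [GreenbergLNM1716] Thm. 4.1.

Pure proof file: no definitions, no named facts, no `sorry`.
-/

noncomputable section

open scoped Classical MatrixGroups ModularForm

open PowerSeries CongruenceSubgroup WeierstrassCurve Literature.NumberTheory.EllipticCurves
  Literature.NumberTheory.EllipticCurves.ModularForms
  Literature.NumberTheory.EllipticCurves.Wuthrich2014
  Literature.NumberTheory.EllipticCurves.Rank1Residual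
  Summit.BirchSwinnertonDyer.BirchSwinnertonDyer.Theorems
  Summit.BirchSwinnertonDyer.BirchSwinnertonDyer.Theorems.Rank1ResidualX1Defs
  Summit.BirchSwinnertonDyer.Rank1Residual.X1.RankOneLeadingTermSqueeze
  Summit.BirchSwinnertonDyer.Rank1Residual.X1.PadicSigmaThree

set_option autoImplicit false

namespace Summit.BirchSwinnertonDyer.Rank1Residual.X1.RankOne

variable {W : WeierstrassCurve ℚ} [W.IsGloballyMinimal] {p : ℕ} [Fact p.Prime]

/-! ### §1. The class: Keller–Yin displays + type-B certificates + SEVEN published binders -/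

/-- **A1 ⇐ Keller–Yin's rank-one display, SIX published binders** (gen 9's
`Leaf.bsdp_of_not_gvPar_of_KY` displayed eight: Greenberg 4.1 is fed from `hS` + `σ`, modularity
"Version `L`" from form (6)): at a leaf pair of type A (`¬ GVPar W p`), `BSD(E,p)` from
`KellerYin2024.thm421_rankOne_display_OPEN` (`hKY`, PREPRINT, explicit), Greenberg–Vatsal (`hGV`),
Perrin-Riou–Schneider at odd `p` (`hS`), modularity (`hmod`), Hoffstein–Luo 1997 (`hHL`), Gross–Zagier
I.7.3 (`hGZ`), GZK (`hGZK`).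
[cite: KellerYin2024, Thm. 4.2.1 and its proof (p. 22) (announced; explicit hypothesis)]
[cite: GreenbergVatsal2000, Thm. (1.3)] [cite: CastellaEtAl2021, Thms. 5.1.4, 5.3.1]
[cite: BalakrishnanMullerStein2015, Thm. 1.7] [cite: BCDTJAMS2001, Thm. A] -/
theorem Leaf.bsdp_of_not_gvPar_of_KY'' [W.IsElliptic] (hKY : KellerYin2024.thm421_rankOne_display_OPEN)
    (hGV : GreenbergVatsal2000.thm13_charIdeal_eq_of_gvPar) (hS : Schneider1985_order_charGenerator_odd)
    (hmod : nonempty_modularParametrizationData) (hHL : HoffsteinLuo1997_exists_twist_L_one_ne_zero)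
    (hGZ : GrossZagier1986_thm_I_7_3) (hGZK : rank_eq_analyticRank_of_analyticRank_le_one)
    (h : Leaf W p) (hA : ¬ GVPar W p) : BSDp W p :=
  h.bsdp_of_not_gvPar_of_KY hKY hGV (greenberg_charValue_rankZero_of_odd hS) hmod
    (exists_isNewformOf_of_nonempty_modularParametrizationData hmod) hHL hGZ hGZK hA

/-- **The rank-one leaf from Keller–Yin on type A and Schneider certificates on type B — SEVEN published
binders** (gen 9's `statement_of_KY_of_schneider_typeB` displayed ten): granted
`KellerYin2024.thm421_rankOne_display_OPEN` (`hKY`, PREPRINT, explicit), Schneider's non-degeneracy at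
every TYPE-B leaf pair (`hSchB`; per pair a finite certificate) and Greenberg–Vatsal (`hGV`),
Perrin-Riou–Schneider (`hS`), Perrin-Riou 1987 (`hPR`), modularity (`hmod`), Hoffstein–Luo (`hHL`),
Gross–Zagier I.7.3 (`hGZ`), GZK (`hGZK`): `Statement`.
[cite: KellerYin2024, Thm. 4.2.1 and its proof (p. 22) (announced; explicit hypothesis)]
[cite: GreenbergVatsal2000, Thm. (1.3)] [cite: PerrinRiou1987, §1.4 Cor. 1.8]
[cite: BalakrishnanMullerStein2015, Thm. 1.7] [cite: MazurSteinTate2006, Thm. 1.3]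
[cite: BCDTJAMS2001, Thm. A and p. 845] -/
theorem statement_of_KY_of_schneider_typeB'' (hKY : KellerYin2024.thm421_rankOne_display_OPEN)
    (hSchB : ∀ (W : WeierstrassCurve ℚ) [W.IsElliptic] [W.IsGloballyMinimal] (p : ℕ) [Fact p.Prime],
      Leaf W p → GVPar W p → ∀ Dh : PAdicHeightData W p, Dh.IsCanonical → SchneiderConjecture Dh)
    (hGV : GreenbergVatsal2000.thm13_charIdeal_eq_of_gvPar) (hS : Schneider1985_order_charGenerator_odd)
    (hPR : perrinRiou_rankOne_leadingTerms_odd) (hmod : nonempty_modularParametrizationData)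
    (hHL : HoffsteinLuo1997_exists_twist_L_one_ne_zero) (hGZ : GrossZagier1986_thm_I_7_3)
    (hGZK : rank_eq_analyticRank_of_analyticRank_le_one) : Statement :=
  statement_of_KY_of_schneider_typeB hKY hSchB hGV (greenberg_charValue_rankZero_of_odd hS) hS hPR
    mazur_tate_sigma_exists_odd_holds hmod (exists_isNewformOf_of_nonempty_modularParametrizationData hmod)
    hHL hGZ hGZK

/-- **THE WHOLE CLASS X1 MODULO THE PREPRINT AND RANK-ONE TYPE-B CERTIFICATES — SEVEN published
binders** (gen 9's `bsdpOnClassX1_of_KY_of_rankZeroDisplay_of_schneider` displayed ten). Granted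
Keller–Yin's STATED Theorems 3.0.11 + 7.0.6 in BOTH rank configurations — the rank-one display
`KellerYin2024.thm421_rankOne_display_OPEN` (`hKY`) and its mirror `RankZeroPartner.RankZeroDisplay`
(`hDisp`), PREPRINT, explicit hypotheses — the typed class target `BSDpOnClassX1` follows from Schneider
certificates at rank-one TYPE-B pairs ONLY (`hSchB` at the B1 leaf pairs; `hW4` at one admissible
B1-partner of each rank-zero leaf pair) and the PUBLISHED named facts Greenberg–Vatsal 2000 Thm. (1.3)
(`hGV`), Perrin-Riou–Schneider at odd `p` (`hS`, BMS 1.7), Perrin-Riou 1987 (`hPR`), modularity in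
BCDT's form (6) (`hmod`), Hoffstein–Luo 1997 (`hHL`), Gross–Zagier I.7.3 (`hGZ`), Gross–Zagier–Kolyvagin
(`hGZK`). Fed by the tree: the Mazur–Tate sigma pair (`mazur_tate_sigma_exists_odd_holds`), Greenberg's
Thm. 4.1 (`greenberg_charValue_rankZero_of_odd hS`), modularity "Version `L`"
(`exists_isNewformOf_of_nonempty_modularParametrizationData hmod`). NO unstated cyclotomic main
conjecture is used; no label change.
[cite: KellerYin2024, Thms. 3.0.11, 7.0.6 and proof of Thm. 4.2.1 (p. 22) (announced; explicit hypotheses)]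
[cite: GreenbergVatsal2000, Thm. (1.3)] [cite: CastellaEtAl2021, Thms. 5.1.4, 5.3.1]
[cite: PerrinRiou1987, §1.4 Cor. 1.8] [cite: BalakrishnanMullerStein2015, Thm. 1.7]
[cite: MazurSteinTate2006, Thm. 1.3] [cite: GreenbergLNM1716, Thm. 4.1 (p. 102)]
[cite: BCDTJAMS2001, Thm. A and p. 845] -/
theorem bsdpOnClassX1_of_KY_of_rankZeroDisplay_of_schneider''
    (hKY : KellerYin2024.thm421_rankOne_display_OPEN) (hDisp : RankZeroPartner.RankZeroDisplay)
    (hW4 : ∀ (W : WeierstrassCurve ℚ) [W.IsElliptic] [W.IsGloballyMinimal] (p : ℕ) [Fact p.Prime],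
      RankZero.Leaf W p → RankZeroPartner.SchneiderPartnerAt W p)
    (hSchB : ∀ (W : WeierstrassCurve ℚ) [W.IsElliptic] [W.IsGloballyMinimal] (p : ℕ) [Fact p.Prime],
      Leaf W p → GVPar W p → ∀ Dh : PAdicHeightData W p, Dh.IsCanonical → SchneiderConjecture Dh)
    (hGV : GreenbergVatsal2000.thm13_charIdeal_eq_of_gvPar) (hS : Schneider1985_order_charGenerator_odd)
    (hPR : perrinRiou_rankOne_leadingTerms_odd) (hmod : nonempty_modularParametrizationData)
    (hHL : HoffsteinLuo1997_exists_twist_L_one_ne_zero) (hGZ : GrossZagier1986_thm_I_7_3)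
    (hGZK : rank_eq_analyticRank_of_analyticRank_le_one) : BSDpOnClassX1 :=
  bsdpOnClassX1_of_KY_of_rankZeroDisplay_of_schneider hKY hDisp hW4 hSchB hGV
    (greenberg_charValue_rankZero_of_odd hS) hS hPR mazur_tate_sigma_exists_odd_holds hmod
    (exists_isNewformOf_of_nonempty_modularParametrizationData hmod) hHL hGZ hGZK

/-- **Granted Keller–Yin, class X1 IS its rank-zero leaf — SIX published binders**:
`BSDpOnClassX1 ↔ RankZero.Statement` (gen 9's `bsdpOnClassX1_iff_rankZeroStatement_of_KY` with
Greenberg 4.1 and modularity "Version `L`" fed).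
[cite: KellerYin2024, Thm. 4.2.1 (p. 22) (announced; explicit hypothesis)]
[cite: BalakrishnanMullerStein2015, Thm. 1.7] [cite: BCDTJAMS2001, Thm. A and p. 845] -/
theorem bsdpOnClassX1_iff_rankZeroStatement_of_KY'' (hKY : KellerYin2024.thm421_rankOne_display_OPEN)
    (hGV : GreenbergVatsal2000.thm13_charIdeal_eq_of_gvPar) (hS : Schneider1985_order_charGenerator_odd)
    (hmod : nonempty_modularParametrizationData) (hHL : HoffsteinLuo1997_exists_twist_L_one_ne_zero)
    (hGZ : GrossZagier1986_thm_I_7_3) (hGZK : rank_eq_analyticRank_of_analyticRank_le_one) :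
    BSDpOnClassX1 ↔ RankZero.Statement :=
  bsdpOnClassX1_iff_rankZeroStatement_of_KY hKY hGV (greenberg_charValue_rankZero_of_odd hS) hmod
    (exists_isNewformOf_of_nonempty_modularParametrizationData hmod) hHL hGZ hGZK

/-! ### §2. The N1 row record on SEVEN published binders -/

section RowRecord

variable {W : WeierstrassCurve ℚ} [W.IsElliptic] [W.IsGloballyMinimal] {p : ℕ} [Fact p.Prime]

/-- **THE EXTENDED ROW RECORD, SEVEN BINDERS (booking form of OFFER v1.5)**: a leaf pair `(E, p)` and a
globally minimal `E′ ∼ E` carrying an extended certificate row (route P₁ ∨ route R with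
`… ≤ v + ord_p ∏c_ℓ(E′) + 2` ∨ route R-CT₂ with `… + 4` and one non-zero element of `Ш(E′)[p]`) ⇒
`BSD(E,p)` — gen 19's `Leaf.bsdp_of_isIsogenous_of_certificateRowSha_two` (p309788, NINE displayed) with
the Mazur–Tate sigma binder supplied by `mazur_tate_sigma_exists_odd_holds` (as in p328883, EIGHT) AND
the entire-continuation binder `hasEntireLFunction_rat` derived from modularity in form (6)
(`X2.ClassClosureEntireFree.hasEntireLFunction_rat_of_nonempty_modularParametrizationData`). Remaining
published named facts: Wuthrich 2014 Thm. 16 (`hW16`),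
Perrin-Riou–Schneider (`hS`, BMS 1.7 odd), Perrin-Riou 1987 (`hPR`), modularity (`hmod`, BCDT form (6)),
GZK (`hGZK`), Cassels 1965 (`hCassels`), Cassels–Tate (`hCT`).
[cite: Wuthrich2014, Thm. 16 (p. 397)] [cite: BalakrishnanMullerStein2015, Thm. 1.7]
[cite: PerrinRiou1987, §1.4 Cor. 1.8] [cite: BCDTJAMS2001, Thm. A and p. 845]
[cite: MilneADT2006, Thm. I.7.3] [cite: MazurSteinTate2006, Thm. 1.3] -/
theorem Leaf.bsdp_of_isIsogenous_of_certificateRowSha_two''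
    (hW16 : Wuthrich2014.charIdeal_dvd_padicLFunction) (hS : Schneider1985_order_charGenerator_odd)
    (hPR : perrinRiou_rankOne_leadingTerms_odd) (hmod : nonempty_modularParametrizationData)
    (hGZK : rank_eq_analyticRank_of_analyticRank_le_one) (hCassels : bsdRHS_eq_of_isIsogenous)
    (hCT : exists_casselsTate_pairing (K := ℚ))
    (hL : Leaf W p) {W' : WeierstrassCurve ℚ} [W'.IsElliptic] [W'.IsGloballyMinimal]
    (hiso : IsIsogenous W W')
    (hrow : ((∀ [NeZero (W'.conductorNorm ℤ)] (f : CuspForm (Gamma0 (W'.conductorNorm ℤ)) 2),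
        IsNewformOf W' f → ∀ (ϖ : ℚ), (ϖ : ℝ) * W'.realPeriodRat = plusPeriod f →
        ‖coeff 1 (C (ϖ : ℚ_[p]) * padicLFunction f (unitRoot W' p : ℚ_[p]))‖ = 1) ∨
      (∃ vc v : ℤ, vc ≠ 0 ∧ AnalyticCoeffOneVal W' p vc ∧
        (∀ Dh : PAdicHeightData W' p, Dh.IsCanonical → v ≤ (padicRegulator Dh).valuation) ∧
        vc + 1 + 2 * padicValNat p W'.torsionOrder ≤ v + padicValNat p W'.tamagawaProduct + 2) ∨
      (∃ vc v : ℤ, vc ≠ 0 ∧ AnalyticCoeffOneVal W' p vc ∧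
        (∀ Dh : PAdicHeightData W' p, Dh.IsCanonical → v ≤ (padicRegulator Dh).valuation) ∧
        vc + 1 + 2 * padicValNat p W'.torsionOrder ≤ v + padicValNat p W'.tamagawaProduct + 4 ∧
        ∃ x : W'.sha, x ≠ 0 ∧ p • x = 0))) :
    BSDp W p :=
  hL.bsdp_of_isIsogenous_of_certificateRowSha_two hW16 hS hPR mazur_tate_sigma_exists_odd_holds hmod
    (X2.ClassClosureEntireFree.hasEntireLFunction_rat_of_nonempty_modularParametrizationData hmod) hGZK
    hCassels hCT hiso hrow

end RowRecord

end Summit.BirchSwinnertonDyer.Rank1Residual.X1.RankOne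

end
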